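import Mathlib.FieldTheory.Minpoly.Field
import Mathlib.RingTheory.Coprime.Lemmas
import Mathlib.RingTheory.PrincipalIdealDomain
import Mathlib.RingTheory.IntegralClosure.Algebra.Basic
import Literature.AlgebraicGeometry.HodgeTheory.RationalClassesRingChange
import Literature.AlgebraicGeometry.HodgeTheory.SupportedClassesRationalProofs
import Literature.AlgebraicGeometry.HodgeTheory.RationalLattice
import HarnessLib

/-!
# A rational Fitting idempotent (stub `stub_rationalFitting`, line `middle-involution-purity`)

For `X` smooth projective over `ℂ` and an endomorphism `j` of `Hᵏ(X(ℂ); ℂ)` preserving rational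
classes which is not nilpotent, some `ℚ`-polynomial multiple `f = p(j) ∘ j` (`p ∈ ℚ[X]`) of `j` is a
non-zero idempotent: the CRT/Fitting idempotent of the Artinian `ℚ`-algebra `ℚ[j]` projecting onto
the part where `j` is invertible (Voisin I, §7.1.1 for `Hᵏ(X, ℚ) ⊗ ℂ = Hᵏ(X, ℂ)`).

Proof: `j` descends to the finite-dimensional `ℚ`-form `Hᵏ(X(ℂ); ℚ)` along the injective change of
coefficients `ι : Hᵏ(X(ℂ); ℚ) → Hᵏ(X(ℂ); ℂ)` (`j ∘ ι = ι ∘ j_ℚ`); factor `minpoly ℚ j_ℚ = X^a · g`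
with `X ∤ g`, write `u X^(a+1) + v g = 1` (Bezout), and take `X * p := u X^(a+1)`; this is
idempotent modulo the minimal polynomial, and if it vanished at `j_ℚ` then `g` would be a unit and
`j_ℚ^a = 0`, whence `j^a = 0` on the `ℂ`-span of the rational classes, which is everything.
-/

noncomputable section

set_option linter.dupNamespace false

namespace Summit.HodgeConjecture.HodgeConjecture.Cruxes.OrthogonalEnveloped.MiddleInvolutionPurity

open scoped BigOperators
open CategoryTheory MonoidalCategory CartesianMonoidalCategory
open Literature.AlgebraicGeometry.Motives (SchemeOver ComplexPoints IsSmoothProjective)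
open Literature.AlgebraicGeometry.HodgeTheory
open Literature.AlgebraicTopology.SingularHomology

open Polynomial

universe u

/-! ### Pure algebra: a Fitting idempotent among the polynomial multiples of an integral element -/

/-- **Fitting/CRT idempotent of `K[f]`.** For an element `f` of a `K`-algebra (`K` a field) that is
integral over `K`, there is `p ∈ K[X]` such that `(X p)(f)` is idempotent, and `(X p)(f) = 0` only if
`f` is nilpotent. (Factor `minpoly K f = X^a g`, `X ∤ g`; Bezout `u X^(a+1) + v g = 1`; take
`X p = u X^(a+1)`: then `(Xp)² - Xp = -u v X · minpoly`, and `(Xp)(f) = 0` forces `g ∣ u`, `g ∣ 1`,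
`f^a = 0`.) [folklore] -/
theorem ratFit_exists_poly_idempotent {K A : Type*} [Field K] [Ring A] [Algebra K A] {f : A}
    (hf : IsIntegral K f) :
    ∃ p : K[X], IsIdempotentElem (aeval f (X * p)) ∧ (aeval f (X * p) = 0 → IsNilpotent f) := by
  obtain ⟨a, g, hμ, hg⟩ : ∃ (a : ℕ) (g : K[X]), minpoly K f = X ^ a * g ∧ ¬ X ∣ g := by
    obtain ⟨g, hμ, hg⟩ :=
      (minpoly K f).exists_eq_pow_rootMultiplicity_mul_and_not_dvd (minpoly.ne_zero hf) 0
    rw [C_0, sub_zero] at hμ hg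
    exact ⟨_, g, hμ, hg⟩
  have hcop : IsCoprime (X ^ (a + 1)) g :=
    (Polynomial.irreducible_X.coprime_iff_not_dvd.2 hg).pow_left
  obtain ⟨u, v, huv⟩ := id hcop
  refine ⟨u * X ^ a, ?_, fun h0 ↦ ⟨a, ?_⟩⟩
  · -- idempotent: `(Xp)·(Xp) = Xp + (-(u v X)) · minpoly`
    have hkey : X * (u * X ^ a) * (X * (u * X ^ a)) =
        X * (u * X ^ a) + -(u * v * X) * minpoly K f := by
      rw [hμ]; linear_combination (X * (u * X ^ a)) * huv
    change aeval f _ * aeval f _ = aeval f _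
    rw [← map_mul, hkey, map_add, map_mul (aeval f) (-(u * v * X)), minpoly.aeval, mul_zero,
      add_zero]
  · -- non-vanishing: else `g ∣ u`, `g` is a unit, `f ^ a = 0`
    have hdvd : minpoly K f ∣ X * (u * X ^ a) := minpoly.dvd K f h0
    have hgμ : g ∣ minpoly K f := ⟨X ^ a, by rw [hμ, mul_comm]⟩
    have hgu' : g ∣ u * X ^ (a + 1) := by
      have : X * (u * X ^ a) = u * X ^ (a + 1) := by ring
      rw [← this]
      exact hgμ.trans hdvd
    have hgu : g ∣ u := hcop.symm.dvd_of_dvd_mul_right hgu'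
    have hg1 : IsUnit g := isUnit_of_dvd_one (by
      rw [← huv]; exact dvd_add (dvd_mul_of_dvd_left hgu _) (dvd_mul_left g v))
    have h := minpoly.aeval K f
    rw [hμ, map_mul, map_pow, aeval_X] at h
    exact (hg1.map (aeval f)).mul_left_eq_zero.1 h

/-! ### Descent of a rational-preserving endomorphism to `Hᵏ(Y; ℚ)` -/

variable {Y : Type u} [TopologicalSpace Y] {k : ℕ}

/-- **Descent.** An endomorphism `j` of `Hᵏ(Y; ℂ)` preserving rational classes restricts along the
injective change of coefficients `ι : Hᵏ(Y; ℚ) → Hᵏ(Y; ℂ)` to a `ℚ`-linear endomorphism `j_ℚ` of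
`Hᵏ(Y; ℚ)` with `ι ∘ j_ℚ = j ∘ ι`. [cite: VoisinHodgeI2002, §7.1.1] -/
theorem ratFit_exists_descent (j : Module.End ℂ (singularCohomology ℂ ℂ Y k))
    (hj : ∀ β, IsRationalClass β → IsRationalClass (j β)) :
    ∃ jq : Module.End ℚ (singularCohomology ℚ ℚ Y k),
      ∀ x, singularCohomology.ringChange (algebraMap ℚ ℂ) Y k (jq x) =
        j (singularCohomology.ringChange (algebraMap ℚ ℂ) Y k x) := by
  choose f hf using fun x : singularCohomology ℚ ℚ Y k ↦
    (hj _ (isRationalClass_ringChange x)).exists_ringChange_eq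
  refine ⟨{ toFun := f, map_add' := fun x y ↦ ?_, map_smul' := fun q x ↦ ?_ }, hf⟩
  · apply ringChange_rat_injective
    rw [hf, map_add, map_add, map_add, hf, hf]
  · apply ringChange_rat_injective
    rw [hf, ringChange_ratCast_smul, RingHom.id_apply, ringChange_ratCast_smul, hf, map_smul]

/-- Powers descend: `jᵐ (ι x) = ι (j_ℚᵐ x)`. [folklore] -/
theorem ratFit_pow_apply_ringChange (j : Module.End ℂ (singularCohomology ℂ ℂ Y k))
    (jq : Module.End ℚ (singularCohomology ℚ ℚ Y k))
    (hjq : ∀ x, singularCohomology.ringChange (algebraMap ℚ ℂ) Y k (jq x) =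
      j (singularCohomology.ringChange (algebraMap ℚ ℂ) Y k x))
    (m : ℕ) (x : singularCohomology ℚ ℚ Y k) :
    (j ^ m) (singularCohomology.ringChange (algebraMap ℚ ℂ) Y k x) =
      singularCohomology.ringChange (algebraMap ℚ ℂ) Y k ((jq ^ m) x) := by
  induction m generalizing x with
  | zero => rw [pow_zero, pow_zero, Module.End.one_apply, Module.End.one_apply]
  | succ m ih =>
    rw [pow_succ, pow_succ, Module.End.mul_apply, Module.End.mul_apply, ← hjq, ih]

/-- Polynomials descend: `P^ℂ(j) (ι x) = ι (P(j_ℚ) x)` for `P ∈ ℚ[X]`, `P^ℂ` its image in `ℂ[X]`.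
[folklore] -/
theorem ratFit_aeval_map_apply_ringChange (j : Module.End ℂ (singularCohomology ℂ ℂ Y k))
    (jq : Module.End ℚ (singularCohomology ℚ ℚ Y k))
    (hjq : ∀ x, singularCohomology.ringChange (algebraMap ℚ ℂ) Y k (jq x) =
      j (singularCohomology.ringChange (algebraMap ℚ ℂ) Y k x))
    (P : ℚ[X]) (x : singularCohomology ℚ ℚ Y k) :
    aeval j (P.map (algebraMap ℚ ℂ)) (singularCohomology.ringChange (algebraMap ℚ ℂ) Y k x) =
      singularCohomology.ringChange (algebraMap ℚ ℂ) Y k (aeval jq P x) := by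
  induction P using Polynomial.induction_on' with
  | add p q hp hq =>
    rw [Polynomial.map_add, map_add, LinearMap.add_apply, hp, hq, map_add, LinearMap.add_apply,
      map_add]
  | monomial m a =>
    rw [Polynomial.map_monomial, aeval_monomial, aeval_monomial, Module.End.mul_apply,
      Module.End.mul_apply, Module.algebraMap_end_apply, Module.algebraMap_end_apply,
      ratFit_pow_apply_ringChange j jq hjq, ringChange_ratCast_smul, eq_ratCast]

/-- Nilpotency ascends when the rational classes span: if `j_ℚ` is nilpotent and
`ℂ · {rational classes} = Hᵏ(Y; ℂ)`, then `j` is nilpotent. [cite: VoisinHodgeI2002, §7.1.1] -/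
theorem ratFit_isNilpotent_of_descent (j : Module.End ℂ (singularCohomology ℂ ℂ Y k))
    (jq : Module.End ℚ (singularCohomology ℚ ℚ Y k))
    (hjq : ∀ x, singularCohomology.ringChange (algebraMap ℚ ℂ) Y k (jq x) =
      j (singularCohomology.ringChange (algebraMap ℚ ℂ) Y k x))
    (hspan : Submodule.span ℂ {c : singularCohomology ℂ ℂ Y k | IsRationalClass c} = ⊤)
    (hnil : IsNilpotent jq) : IsNilpotent j := by
  obtain ⟨a, ha⟩ := hnil
  refine ⟨a, LinearMap.ext_on hspan ?_⟩
  rintro c hc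
  obtain ⟨x, rfl⟩ := (isRationalClass_iff_exists_ringChange c).1 hc
  rw [ratFit_pow_apply_ringChange j jq hjq, ha, LinearMap.zero_apply, LinearMap.zero_apply,
    map_zero]

/-! ### The stub -/

/-- **A RATIONAL FITTING IDEMPOTENT.** For `X` smooth projective (so `Hᵏ(X(ℂ); ℚ)` is
finite-dimensional, `finite_singularCohomology_rat_complexPoints`, and `Hᵏ(X(ℂ); ℂ)` is spanned by
its rational classes, `span_isRationalClass_eq_top_of_isSmoothProjective_holds`) and an
endomorphism `j` of `Hᵏ(X(ℂ); ℂ)` preserving rational classes which is NOT nilpotent, some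
`ℚ`-polynomial multiple `f = p(j) ∘ j` of `j` (`p ∈ ℚ[X]`) is a NON-ZERO IDEMPOTENT: `j` restricts
to `Hᵏ(X(ℂ); ℚ)` (`j ∘ ι = ι ∘ j_ℚ`, `ι = ringChange` injective); factor `minpoly ℚ j_ℚ = X^a · g`
with `X ∤ g`, Bezout `u X^(a+1) + v g = 1`, `X p := u X^(a+1)` is idempotent at `j_ℚ` and non-zero
(else `g ∣ u`, `g ∣ 1`, `j_ℚ^a = 0`, `j^a = 0`); the identities transfer from `Hᵏ(ℚ)` to its
`ℂ`-span `Hᵏ(ℂ)`. (The CRT/Fitting idempotent of the Artinian `ℚ`-algebra `ℚ[j]` projecting onto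
the part where `j` is invertible.) [cite: VoisinHodgeI2002, §7.1.1] -/
theorem stub_rationalFitting :
    ∀ (n : ℕ) (X : SchemeOver ℂ), IsSmoothProjective n X → ∀ (k : ℕ)
      (j : Module.End ℂ (complexBetti X k)), (∀ β, IsRationalClass β → IsRationalClass (j β)) →
        ¬ IsNilpotent j →
          ∃ p : Polynomial ℚ,
            IsIdempotentElem (Polynomial.aeval j ((Polynomial.X * p).map (algebraMap ℚ ℂ))) ∧
            Polynomial.aeval j ((Polynomial.X * p).map (algebraMap ℚ ℂ)) ≠ 0 := by
  intro n X hX k j hj hnil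
  haveI := finite_singularCohomology_rat_complexPoints hX k
  have hspan := span_isRationalClass_eq_top_of_isSmoothProjective_holds n X hX k
  obtain ⟨jq, hjq⟩ := ratFit_exists_descent j hj
  obtain ⟨p, hidem, hzero⟩ :=
    ratFit_exists_poly_idempotent (Algebra.IsIntegral.isIntegral (R := ℚ) jq)
  have htr := ratFit_aeval_map_apply_ringChange j jq hjq (Polynomial.X * p)
  refine ⟨p, ?_, fun h0 ↦ hnil ?_⟩
  · -- idempotency transfers along `ι` and the rational classes span
    refine LinearMap.ext_on hspan ?_
    rintro c hc
    obtain ⟨x, rfl⟩ := (isRationalClass_iff_exists_ringChange c).1 hc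
    rw [Module.End.mul_apply, htr, htr, ← Module.End.mul_apply, hidem.eq]
  · -- `(Xp)(j) = 0` forces `(Xp)(j_ℚ) = 0` (injectivity of `ι`), so `j_ℚ`, hence `j`, is nilpotent
    refine ratFit_isNilpotent_of_descent j jq hjq hspan (hzero (LinearMap.ext fun x ↦ ?_))
    apply ringChange_rat_injective
    rw [← htr, h0, LinearMap.zero_apply, LinearMap.zero_apply, map_zero]

end Summit.HodgeConjecture.HodgeConjecture.Cruxes.OrthogonalEnveloped.MiddleInvolutionPurity

end
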